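import Summits.CriticalPhenomena.SAWScalingLimit.Theorems.SAWDefectDecoherenceObservableToSLERSeqReduction
import HarnessLib

/-!
# The carved laws of realised cells are probability measures, eventually (piece (G0) of stub T2b″)

Crux `SAWDevelopingMap.ObservableToSLE` (stmt-CriticalPhenomena-10472), line `six-class-type-ladder`,
stub T2b″ `stub_carvedReduction_squeezeSolid`.  Landing target:
`Summits/CriticalPhenomena/SAWScalingLimit/Theorems/SAWDevelopingMapObservableToSLETypeLadderCarvedReductionSqueezeProb.lean`
(`--supports stmt-CriticalPhenomena-10472`).

The squeeze package consumed by the ratio squeeze (`TypeLadder.stub_carvedReduction_ratioSqueeze`,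
p131716) asks that the carved laws `carvedLaw D (δ_k) (S_k(n_k) ∪ T_k(n'_k)) q_k q'_k` of the
realised cells be PROBABILITY measures (the exact sandwich divides by the total carved weight).
Unlike the carved sequential identification, the moving-carving squeeze does not carry this as a
hypothesis; but it holds eventually along every mesh sequence once the locality scale `R` is at most
the product-cell scale `R₁(D, a, b)` of `NestedGate.eventually_productCellN` (landed): then every
walk lies in a product cell, the realised walk lies in the cylinder of its own gate label, and that
cylinder's weight is the prefix/suffix weight times the total carved weight
(`NestedGate.isProbabilityMeasure_carvedLaw_of_isFirstGoodGateN`, landed).  This file packages it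
in the form used by the geometric half of T2b″ (`eventually_isProbabilityMeasure_carvedLaw`,
registered as `stub_carvedReduction_carvedLawProb`): the `R₀` of the squeeze is taken `≤ R₁`.
-/

noncomputable section

open scoped Topology
open Filter Set MeasureTheory Metric
open Literature.Probability.LatticeModels (HexVertex hexGraph hexCenter Site)
open Literature.Probability.RandomPlanarGeometry
open Literature.Probability.RandomPlanarGeometry.SAW

namespace Summit.CriticalPhenomena.SAWScalingLimit.Theorems.ObservableToSLE.TypeLadder

open Summit.CriticalPhenomena.SAWScalingLimit.Theorems.ObservableToSLER.BridgeGate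
open Summit.CriticalPhenomena.SAWScalingLimit.Theorems.ObservableToSLER.NestedGate
open Summit.CriticalPhenomena.SAWScalingLimit.Theorems.ObservableToSLER.NestedGate.SeqReduction
  (isProbabilityMeasure_carvedLaw_of_isFirstGoodGateN)

/-- **The carved laws of realised cells are probability measures, eventually.**  For a Dobrushin
domain with endpoint approximations there is `R₁ > 0` such that for every locality scale
`R ∈ (0, R₁]`, all `ρ`, `N`, every mesh sequence `δ k → 0⁺` with tame nested families and realised
first good gates `(n k; q k)`, `(n' k; q' k)`: eventually in `k`, the carved law of the cell
`S k (n k) ∪ T k (n' k)` from `q k` to `q' k` is a probability measure. -/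
theorem eventually_isProbabilityMeasure_carvedLaw (D : DobrushinDomain) (a b : ℝ → HexVertex)
    (hab : IsEmbEndpointApprox hexGraph hexCenter D a b) :
    ∃ R₁ > (0 : ℝ), ∀ R ∈ Set.Ioc (0 : ℝ) R₁, ∀ (ρ : ℝ) (N : ℕ) (δ : ℕ → ℝ) (S T : ℕ → ℕ → Set HexVertex)
      (n n' : ℕ → ℕ) (q q' : ℕ → HexVertex),
      Tendsto δ atTop (𝓝[>] 0) →
      (∀ k, TameNestedFamily (δ k) R N (a (δ k)) (S k) ∧ TameNestedFamily (δ k) R N (b (δ k)) (T k)) →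
      (∀ k, ∃ (γ : HexDomainSAW D.carrier (δ k) (a (δ k)) (b (δ k))) (m : ℕ) (p : HexVertex)
          (m' : ℕ) (p' : HexVertex),
        IsFirstGoodGateN D.carrier (δ k) ρ R (S k) (a (δ k)) γ.walk.support (n k) m p (q k) ∧
        IsFirstGoodGateN D.carrier (δ k) ρ R (T k) (b (δ k)) γ.walk.support.reverse (n' k) m' p' (q' k)) →
      ∀ᶠ k : ℕ in atTop, IsProbabilityMeasure
        (carvedLaw D.carrier (δ k) (S k (n k) ∪ T k (n' k)) (q k) (q' k)) := by
  obtain ⟨R₁, hR₁, hcells⟩ := eventually_productCellN D a b hab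
  refine ⟨R₁, hR₁, fun R hR ρ N δ S T n n' q q' hδ hfam hgates => ?_⟩
  have hev := hδ.eventually (hcells R hR ρ N)
  have hpos : ∀ᶠ k : ℕ in atTop, 0 < δ k :=
    hδ.eventually (eventually_mem_nhdsWithin (a := (0 : ℝ)) (s := Ioi 0))
  filter_upwards [hev, hpos] with k hk hδk
  obtain ⟨γ, m, p, m', p', h₁, h₂⟩ := hgates k
  exact isProbabilityMeasure_carvedLaw_of_isFirstGoodGateN D.isBounded hδk
    (hk (S k) (T k) (hfam k).1 (hfam k).2 γ) h₁ h₂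

/-- **Registered sub-goal `stub_carvedReduction_carvedLawProb`** (crux item stmt-CriticalPhenomena-10472,
stub T2b″ `stub_carvedReduction_squeezeSolid`, piece (G0) CARVED LAWS OF REALISED CELLS ARE EVENTUALLY
PROBABILITY): registry form of `eventually_isProbabilityMeasure_carvedLaw`. -/
theorem stub_carvedReduction_carvedLawProb :
    ∀ (D : DobrushinDomain) (a b : ℝ → HexVertex), IsEmbEndpointApprox hexGraph hexCenter D a b →
      ∃ R₁ > (0 : ℝ), ∀ R ∈ Set.Ioc (0 : ℝ) R₁, ∀ (ρ : ℝ) (N : ℕ) (δ : ℕ → ℝ) (S T : ℕ → ℕ → Set HexVertex)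
        (n n' : ℕ → ℕ) (q q' : ℕ → HexVertex),
        Tendsto δ atTop (𝓝[>] 0) →
        (∀ k, TameNestedFamily (δ k) R N (a (δ k)) (S k) ∧ TameNestedFamily (δ k) R N (b (δ k)) (T k)) →
        (∀ k, ∃ (γ : HexDomainSAW D.carrier (δ k) (a (δ k)) (b (δ k))) (m : ℕ) (p : HexVertex)
            (m' : ℕ) (p' : HexVertex),
          IsFirstGoodGateN D.carrier (δ k) ρ R (S k) (a (δ k)) γ.walk.support (n k) m p (q k) ∧
          IsFirstGoodGateN D.carrier (δ k) ρ R (T k) (b (δ k)) γ.walk.support.reverse (n' k) m' p' (q' k)) →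
        ∀ᶠ k : ℕ in atTop, IsProbabilityMeasure
          (carvedLaw D.carrier (δ k) (S k (n k) ∪ T k (n' k)) (q k) (q' k)) :=
  fun D a b hab => eventually_isProbabilityMeasure_carvedLaw D a b hab

end Summit.CriticalPhenomena.SAWScalingLimit.Theorems.ObservableToSLE.TypeLadder

end
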